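/-
Origin: expansion seat `planner-pub-hodgecm-pv07-g4-0`, handover #2 2026-08-18T11:42:45Z (`HOME/pub-hodgecm-pv07-g4/lean/Pv07g4/GenuineSchrodingerShift.lean`, md5 44deaca5, 574 lines);
landed by the gen-8 packager in gate run 29 as `HodgeCM/PerL34/GenuineSchrodingerShift.lean` (import ^import Pv07g4\.GenuineSchrodingerCoeff[ \t]*$→import HodgeCM.PerL34.GenuineSchrodingerCoeff ×1).
-/
/-
Copyright (c) 2026. All rights reserved.
Released under Apache 2.0 license as described in the file LICENSE.

# `HodgeCM/PerL34/GenuineSchrodingerShift.lean` — the S3 input and ALL torus-side END binders for finite sets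
# `S` containing SPLIT places (DAG-node prover #07 gen 4, unit `pub-hodgecm-pv07-g4`, file #2, RUN 29)

WIP module name `Pv07g4.GenuineSchrodingerShift`; lands as `HodgeCM.PerL34.GenuineSchrodingerShift`.
Imports pv07-g4 #1 `GenuineSchrodingerCoeff` (WIP `Pv07g4.GenuineSchrodingerCoeff`; ONE import rewrite at intake)
and the tree module `HodgeCM.PerL34.GenuineSchrodingerLevel` (pv13-g4, RUN 28) for the character radius
`exists_radius_forall_U1_char_eq_one`.  Nothing of the tree is touched.

## What this file proves (no placeholders, no new axioms, no cited facts)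

pv13-g4's `thetaInputOfNonsplit` and pv07-g4 #1's `thetaInputTwist` / `torusSide` inhabit the S3 input structure
`GenuineThetaInput L S …` and the END theorem's `(ω, φ)`-binders only for finite sets `S` of NON-SPLIT places,
because their vector is `φ⁰ = ⊗_v 1_{𝒪_v³}` and the structure demands, at a split `v ∈ S`, a ball
`D_v = closedBall x₀ r` with `r < ‖x₀‖` (so `0 ∉ D_v`) as the `v`-component (GAPS `pv13g4-A4` residual (a)).
Since the END theorem needs `T' ⊆ S` (`T'` the level of `χ`), that left out every `χ` RAMIFIED AT A SPLIT PLACE.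

Here, for EVERY finite set `S` of places of `L⁺` and every character `χ` of the model group with a level `T'`
(`K_{T'} ≤ ker χ`, local components continuous on `T'`):
* §1–§2 the SHIFTED vector `φ_e = 1_{e + ∏ 𝒪_v³}` (`phiE e`, any `e ∈ X`) and the shifted coordinate intertwiners
  `V^e_v f = 1_{e + cyl v} · f(x_v)` (`Ve e v`, linear isometries `L²((L⁺_v)³) → L²(X)`; the `v`-coordinate is
  measure preserving on `e + cyl v` by translation invariance of both Haar measures), with the equivariance
  `ω(ι_v g) V^e_v = V^e_v ω_v(baseTriv g)` (`rep_mulSingle_Ve`) and `V^e_v 1_{closedBall e_v 1} = φ_e`;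
* §3 `hK` for `φ_e` on every level `K_T` with `e` supported in `T` (`rep_phiE_eq_self_of_mem_boxSubgroup_of_char`),
  the diagonal coefficient `⟪φ_e, ω_ν(k) φ_e⟫ = weight_ν(k) ∏_j vol_j((e_j + 𝒪³) ∩ u_j⁻¹(e_j + 𝒪³))`
  (`inner_phiE_rep`, from #1's product formula `measure_subbox` after translating by `-e`), its multiplicativity on
  disjointly supported pairs and `hM` (`inner_phiE_rep_extendOne`, every finite `S`, every `ν`);
* §4–§5 the CHOICE: at a split `v` a centre `x₀ = (t_v, t_v, t_v)` with `‖t_v‖ > 1` so large that `χ(ι_v g) = 1`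
  whenever `baseTriv g ∈ U1 x₀ 1 = 1 + t_v⁻¹𝒪_v` (`exists_centre`: pv13-g4's character radius at the centre
  `(1,1,1)`, rescaled — the radius stays `1`, so `D_v = x₀ + 𝒪_v³` is a TRANSLATE of `𝒪_v³` of volume one and no
  renormalisation of the vector is needed), the shift `e = e(S, χ)` with `e_v = x₀` at the split `v ∈ S` and `0`
  elsewhere, and `thetaInputShift S χ hχT' hlocχ : GenuineThetaInput L S (Lp ℂ 2 (μ L)) (rep L ν_χ) φ_e χ`
  (`ν_χ` = #1's scalar twist; `ν_v = 1`, `r_v = 1`, `a_v = 1`, `VU_v = VS_v = V^e_v`);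
* §6 `torusSideShift`: `⟨X, ‖φ_e‖ = 1, hloc, hK (T := S), hM⟩` from the END's own `χ`-side hypotheses `hχT'`,
  `hlocχ`, `T' ⊆ S` — i.e. the torus side of `exists_compactDomain_thetaLift_ne_zero_genuine_of_input` is inhabited
  for EVERY admissible `(S, χ, T')`, split ramification included.

ABSOLUTE RULE respected: every hypothesis of every theorem below is kernel-discharged in this package; no statement
of PerL / QW8 / the 2001 programme is used; no `def … : Prop` hypothesis is introduced.
-/
import Summits.HodgeConjecture.HodgeCM.PerL34.GenuineSchrodingerCoeff_3
import Summits.HodgeConjecture.HodgeCM.PerL34.GenuineSchrodingerLevel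

/-! PORT of `HodgeCM/PerL34/GenuineSchrodingerShift.lean` (HodgeCMPerL run 82) — verbatim mechanical port; provenance in the PORT header line. -/

set_option linter.style.longFile 0
set_option linter.unusedSectionVars false
set_option linter.unusedVariables false

noncomputable section

open MeasureTheory MeasureTheory.Measure Set Metric Function Complex ComplexConjugate Topology Filter
open scoped RestrictedProduct InnerProductSpace NNReal ENNReal Pointwise

namespace HodgeCM.PerL34.PureTensor

open HodgeCM.PerL34.LocalFactors HodgeCM.PerL34.LocalFactors.DilationModel
open HodgeCM.PerL34.IdelePlaces HodgeCM.PerL34.RestrictedRegroup HodgeCM.PerL34.RestrictedCutout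
open HodgeCM.PerL34.IdelicTorusModel HodgeCM.PerL34.IdelicTorusModel.Genuine NumberField IsDedekindDomain
open HodgeCM.PerL34.NoSmallSubgroups

attribute [local instance] LocalFactors.DilationModel.Adic.nontriviallyNormedField
  LocalFactors.DilationModel.Adic.properSpace

/-- rescaling the centre of `U1`: `U1 (t • x₀) s = U1 x₀ (s / ‖t‖)` -/
theorem mem_U1_smul_iff {F : Type*} [NormedField F] {t : F} (ht : t ≠ 0) (x₀ : Fin 3 → F) (s : ℝ) (y : F) :
    y ∈ U1 (t • x₀) s ↔ y ∈ U1 x₀ (s / ‖t‖) := by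
  rw [mem_U1, mem_U1, smul_comm, norm_smul, mul_comm ‖t‖, ← le_div_iff₀ (norm_pos_iff.2 ht)]

namespace SchrodingerModel

variable {L : Type} [Field L] [NumberField L] [IsCMField L]

local notation3 "L⁺" => maximalRealSubfield L

/-- shorthand: the base local field `L⁺_v` at a split index -/
local notation3 "𝕂" i => (basePlaceOf L (Subtype.val i)).adicCompletion (maximalRealSubfield L)

namespace Coeff

section Main

variable [∀ v : HeightOneSpectrum (𝓞 (maximalRealSubfield L)), MeasurableSpace (v.adicCompletion (maximalRealSubfield L))]
  [∀ v : HeightOneSpectrum (𝓞 (maximalRealSubfield L)), BorelSpace (v.adicCompletion (maximalRealSubfield L))]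
  [DecidableEq (Place (maximalRealSubfield L))]

/-! ## §1  The shifted box `e + ∏ 𝒪_v³`, the shifted cylinders and the shifted vector `φ_e` -/

/-- the shifted box `e + ∏_v 𝒪_v³ = {x | x_j - e_j ∈ 𝒪_j³ for all j}` -/
def boxE (e : Space L) : Set (Space L) := (fun x : Space L => -e + x) ⁻¹' (box L : Set (Space L))

/-- (Ported verbatim from the HodgeCMPerL package; no docstring in the source.) -/
theorem mem_boxE_iff (e x : Space L) : x ∈ boxE e ↔ ∀ j, -e j + x j ∈ cube L j := by
  simp only [boxE, mem_preimage, mem_box_iff, RestrictedProduct.add_apply, RestrictedProduct.neg_apply]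

/-- (Ported verbatim from the HodgeCMPerL package; no docstring in the source.) -/
theorem isOpen_boxE (e : Space L) : IsOpen (boxE e) :=
  (isOpen_box L).preimage (continuous_const.add continuous_id)

/-- (Ported verbatim from the HodgeCMPerL package; no docstring in the source.) -/
theorem measurableSet_boxE (e : Space L) : MeasurableSet (boxE e) := (isOpen_boxE e).measurableSet

/-- (Ported verbatim from the HodgeCMPerL package; no docstring in the source.) -/
theorem μ_boxE (e : Space L) : μ L (boxE e) = 1 := by
  rw [boxE, measure_preimage_add, μ_box]

/-- the shifted cylinder `e + cyl v = {x | x_j - e_j ∈ 𝒪_j³ for all j ≠ v}` -/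
def cylE (e : Space L) (i : SplitIdx L) : Set (Space L) := (fun x : Space L => -e + x) ⁻¹' cyl L i

/-- (Ported verbatim from the HodgeCMPerL package; no docstring in the source.) -/
theorem mem_cylE_iff (e : Space L) (i : SplitIdx L) (x : Space L) :
    x ∈ cylE e i ↔ ∀ j, j ≠ i → -e j + x j ∈ cube L j := by
  simp only [cylE, mem_preimage, mem_cyl_iff, RestrictedProduct.add_apply, RestrictedProduct.neg_apply]

/-- (Ported verbatim from the HodgeCMPerL package; no docstring in the source.) -/
theorem measurableSet_cylE (e : Space L) (i : SplitIdx L) : MeasurableSet (cylE e i) :=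
  ((isOpen_cyl i).preimage (continuous_const.add continuous_id)).measurableSet

/-- (Ported verbatim from the HodgeCMPerL package; no docstring in the source.) -/
theorem neg_add_mem_cube_iff (j : SplitIdx L) (c z : Coord L j) : -c + z ∈ cube L j ↔ z ∈ closedBall c 1 := by
  rw [mem_cube_iff, mem_closedBall, dist_eq_norm, neg_add_eq_sub]

/-- (Ported verbatim from the HodgeCMPerL package; no docstring in the source.) -/
theorem boxE_eq_cylE_inter (e : Space L) (i : SplitIdx L) :
    boxE e = cylE e i ∩ (fun x : Space L => x i) ⁻¹' closedBall (e i) 1 := by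
  ext x
  rw [mem_boxE_iff, mem_inter_iff, mem_cylE_iff, mem_preimage, ← neg_add_mem_cube_iff]
  constructor
  · intro h
    exact ⟨fun j _ => h j, h i⟩
  · rintro ⟨h1, h2⟩ j
    by_cases hj : j = i
    · subst hj
      exact h2
    · exact h1 j hj

/-- **the `v`-coordinate is measure preserving on the shifted cylinder** (translate by `-e` inside `X`, use
pv13-g4's `measurePreserving_eval`, translate back by `e_v` inside `(L⁺_v)³`; both Haar measures are invariant) -/
theorem measurePreserving_evalE (e : Space L) (i : SplitIdx L) :
    MeasurePreserving (fun x : Space L => x i) ((μ L).restrict (cylE e i)) (Adic.muV L⁺ (basePlaceOf L i.1)) := by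
  have h1 : MeasurePreserving (fun x : Space L => -e + x) ((μ L).restrict (cylE e i)) ((μ L).restrict (cyl L i)) :=
    (measurePreserving_add_left (μ L) (-e)).restrict_preimage (measurableSet_cyl i)
  have key : (fun x : Space L => x i) =
      ((fun y : Coord L i => e i + y) ∘ fun x : Space L => x i) ∘ fun x : Space L => -e + x := by
    funext x
    simp only [Function.comp_apply, RestrictedProduct.add_apply, RestrictedProduct.neg_apply, add_neg_cancel_left]
  rw [key]
  exact ((measurePreserving_add_left (Adic.muV L⁺ (basePlaceOf L i.1)) (e i)).comp (measurePreserving_eval i)).comp h1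

/-- the shifted vector `φ_e = 1_{e + ∏ 𝒪_v³} ∈ L²(X)` -/
def phiE (e : Space L) : Lp ℂ 2 (μ L) :=
  indicatorConstLp 2 (measurableSet_boxE e) (by rw [μ_boxE]; exact ENNReal.one_ne_top) (1 : ℂ)

/-- (Ported verbatim from the HodgeCMPerL package; no docstring in the source.) -/
theorem norm_phiE (e : Space L) : ‖phiE e‖ = 1 := by
  rw [phiE, norm_indicatorConstLp (by norm_num) (by norm_num), norm_one, one_mul, measureReal_def, μ_boxE,
    ENNReal.toReal_one, Real.one_rpow]

/-! ## §2  The shifted coordinate intertwiners `V^e_v : L²((L⁺_v)³) ↪ L²(X)` -/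

/-- `(V^e_v f)(x) = 1_{e + cyl v}(x) f(x_v)`, a linear isometry -/
def Ve (e : Space L) (i : SplitIdx L) : Lp ℂ 2 (Adic.muV L⁺ (basePlaceOf L i.1)) →ₗᵢ[ℂ] Lp ℂ 2 (μ L) :=
  (extendByZero (measurableSet_cylE e i)).comp
    (Lp.compMeasurePreservingₗᵢ ℂ (fun x : Space L => x i) (measurePreserving_evalE e i))

/-- (Ported verbatim from the HodgeCMPerL package; no docstring in the source.) -/
theorem coeFn_Ve (e : Space L) (i : SplitIdx L) (f : Lp ℂ 2 (Adic.muV L⁺ (basePlaceOf L i.1))) :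
    ⇑(Ve e i f) =ᵐ[μ L] (cylE e i).indicator (fun x => f (x i)) := by
  refine (coeFn_extendByZero (measurableSet_cylE e i) _).trans ?_
  exact (ae_eq_restrict_iff_indicator_ae_eq (measurableSet_cylE e i)).1
    (Lp.coeFn_compMeasurePreserving f (measurePreserving_evalE e i))

/-- (Ported verbatim from the HodgeCMPerL package; no docstring in the source.) -/
theorem smul_mem_cylE_iff (e : Space L) (k : Model L) (i : SplitIdx L)
    (hk : ∀ j : SplitIdx L, j ≠ i → unitAt k j = 1) (x : Space L) : k • x ∈ cylE e i ↔ x ∈ cylE e i := by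
  simp only [mem_cylE_iff, smul_apply]
  refine forall₂_congr fun j hj => ?_
  rw [hk j hj, Units.val_one, one_smul]

/-- **equivariance of `V^e_v`** under an element of the model group supported at `v` -/
theorem rep_apply_Ve (e : Space L) (k : Model L) (i : SplitIdx L) (hk : ∀ j : SplitIdx L, j ≠ i → unitAt k j = 1)
    (f : Lp ℂ 2 (Adic.muV L⁺ (basePlaceOf L i.1))) :
    rep L 1 k (Ve e i f) = Ve e i (dilationRep (Adic.muV L⁺ (basePlaceOf L i.1))
      (1 : (𝕂 i)ˣ →* Circle) (unitAt k i) f) := by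
  apply Lp.ext
  have h1 := coeFn_dilationRep (μ L) (1 : Model L →* Circle) k (Ve e i f)
  have h2 := (quasiMeasurePreserving_smul' (μ L) k).ae_eq_comp (coeFn_Ve e i f)
  have h3 := coeFn_Ve e i (dilationRep (Adic.muV L⁺ (basePlaceOf L i.1)) (1 : (𝕂 i)ˣ →* Circle) (unitAt k i) f)
  have h4 := (ae_eq_restrict_iff_indicator_ae_eq (measurableSet_cylE e i)).1
    ((measurePreserving_evalE e i).quasiMeasurePreserving.ae_eq_comp
      (coeFn_dilationRep (Adic.muV L⁺ (basePlaceOf L i.1)) (1 : (𝕂 i)ˣ →* Circle) (unitAt k i) f))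
  filter_upwards [h1, h2, h3, h4] with x e1 e2 e3 e4
  simp only [Function.comp_def] at e2 e4
  rw [e1, e2, e3, e4]
  by_cases hx : x ∈ cylE e i
  · rw [indicator_of_mem ((smul_mem_cylE_iff e k i hk x).2 hx), indicator_of_mem hx, smul_apply, weight_eq k i hk]
    rfl
  · rw [indicator_of_notMem (mt (smul_mem_cylE_iff e k i hk x).1 hx), indicator_of_notMem hx, mul_zero]

/-- the same for the embedded local element `ι_v(g)` read through `baseTriv` -/
theorem rep_mulSingle_Ve (e : Space L) (i : SplitIdx L) (g : locTorus L⁺ L i.1)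
    (f : Lp ℂ 2 (Adic.muV L⁺ (basePlaceOf L i.1))) :
    rep L 1 (RestrictedProduct.mulSingle (genLevel L) i.1 g) (Ve e i f)
      = Ve e i (dilationRep (Adic.muV L⁺ (basePlaceOf L i.1)) (1 : (𝕂 i)ˣ →* Circle) (baseTriv L i.1 i.2 g) f) := by
  rw [← unitAt_mulSingle_self i g]
  exact rep_apply_Ve e _ i (fun j hj => unitAt_mulSingle_of_ne j (fun h => hj (Subtype.ext h)) g) f

/-- `V^e_v 1_{closedBall e_v 1} = φ_e` -/
theorem Ve_ballIndicator (e : Space L) (i : SplitIdx L) :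
    Ve e i (ballIndicator (Adic.muV L⁺ (basePlaceOf L i.1)) (e i) 1) = phiE e := by
  apply Lp.ext
  have h1 := coeFn_Ve e i (ballIndicator (Adic.muV L⁺ (basePlaceOf L i.1)) (e i) 1)
  have h2 := (ae_eq_restrict_iff_indicator_ae_eq (measurableSet_cylE e i)).1
    ((measurePreserving_evalE e i).quasiMeasurePreserving.ae_eq_comp
      (indicatorConstLp_coeFn (p := 2) (μ := Adic.muV L⁺ (basePlaceOf L i.1))
        (hs := measurableSet_closedBall (x := e i) (ε := 1))
        (hμs := (isCompact_closedBall (e i) 1).measure_lt_top.ne) (c := (1 : ℂ))))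
  have h3 := indicatorConstLp_coeFn (p := 2) (μ := μ L) (hs := measurableSet_boxE e)
    (hμs := by rw [μ_boxE]; exact ENNReal.one_ne_top) (c := (1 : ℂ))
  filter_upwards [h1, h2, h3] with x e1 e2 e3
  rw [e1, show (cylE e i).indicator (fun x : Space L => (ballIndicator (Adic.muV L⁺ (basePlaceOf L i.1)) (e i) 1 :
    Coord L i → ℂ) (x i)) x = _ from e2, phiE, e3]
  simp only [Function.comp_def]
  by_cases hx : x ∈ boxE e
  · have hx' := hx
    rw [boxE_eq_cylE_inter e i] at hx'
    rw [indicator_of_mem hx, indicator_of_mem hx'.1, indicator_of_mem (show x i ∈ closedBall (e i) 1 from hx'.2)]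
  · rw [indicator_of_notMem hx]
    by_cases hc : x ∈ cylE e i
    · rw [indicator_of_mem hc, indicator_of_notMem]
      intro hb
      exact hx ((boxE_eq_cylE_inter e i).symm ▸ ⟨hc, hb⟩)
    · rw [indicator_of_notMem hc]

/-! ## §3  `hK` and `hM` for the shifted vector -/

/-- a `k` with norm-one split coordinates, equal to one wherever `e` is non-zero, preserves the shifted box -/
theorem smul_mem_boxE_iff (e : Space L) (k : Model L) (hk : ∀ j : SplitIdx L, ‖((unitAt k j : (𝕂 j)ˣ) : 𝕂 j)‖ = 1)
    (hke : ∀ j : SplitIdx L, unitAt k j = 1 ∨ e j = 0) (x : Space L) : k • x ∈ boxE e ↔ x ∈ boxE e := by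
  simp only [mem_boxE_iff, smul_apply]
  refine forall_congr' fun j => ?_
  rcases hke j with h | h
  · rw [h, Units.val_one, one_smul]
  · rw [h, neg_zero, zero_add, zero_add]
    exact smul_mem_cube_iff j (hk j) (x j)

/-- `ω_ν(k) φ_e = ν(k) φ_e` for such `k` -/
theorem rep_phiE_of_norm_unitAt (e : Space L) (ν : Model L →* Circle) (k : Model L)
    (hk : ∀ j : SplitIdx L, ‖((unitAt k j : (𝕂 j)ˣ) : 𝕂 j)‖ = 1) (hke : ∀ j : SplitIdx L, unitAt k j = 1 ∨ e j = 0) :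
    rep L ν k (phiE e) = ((ν k : Circle) : ℂ) • phiE e := by
  apply Lp.ext
  have h1 := coeFn_dilationRep (μ L) ν k (phiE e)
  have h3 := indicatorConstLp_coeFn (p := 2) (μ := μ L) (hs := measurableSet_boxE e)
    (hμs := by rw [μ_boxE]; exact ENNReal.one_ne_top) (c := (1 : ℂ))
  have h2 := (quasiMeasurePreserving_smul' (μ L) k).ae_eq_comp h3
  filter_upwards [h1, h2, h3, Lp.coeFn_smul (((ν k : Circle) : ℂ)) (phiE e)] with x e1 e2 e3 e4
  rw [e1, e4, Pi.smul_apply, smul_eq_mul, weight_eq_of_norm ν k hk]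
  congr 1
  simp only [Function.comp_def] at e2
  rw [phiE, e2, e3]
  by_cases hx : x ∈ boxE e
  · rw [indicator_of_mem hx, indicator_of_mem ((smul_mem_boxE_iff e k hk hke x).2 hx)]
  · rw [indicator_of_notMem hx, indicator_of_notMem (mt (smul_mem_boxE_iff e k hk hke x).1 hx)]

/-- **`hK` for the shifted vector**: a level subgroup `K_T` fixes `φ_e` as soon as `e` is supported in `T` and
`ν` is trivial on `K_T` -/
theorem rep_phiE_eq_self_of_mem_boxSubgroup_of_char (e : Space L) (ν : Model L →* Circle) (T : Finset (Place L⁺))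
    (he : ∀ j : SplitIdx L, j.1 ∉ T → e j = 0)
    (hν : ∀ k ∈ RestrictedProduct.boxSubgroup (genLevel L) T, ν k = 1) :
    ∀ k ∈ RestrictedProduct.boxSubgroup (genLevel L) T, rep L ν k (phiE e) = phiE e := fun k hk => by
  have hke : ∀ j : SplitIdx L, unitAt k j = 1 ∨ e j = 0 := fun j => by
    by_cases hj : j.1 ∈ T
    · exact Or.inl (unitAt_eq_one_of_apply_eq_one (((RestrictedProduct.mem_boxSubgroup_iff T k).1 hk).2 j.1 hj))
    · exact Or.inr (he j hj)
  rw [rep_phiE_of_norm_unitAt e ν k (norm_unitAt_of_mem_boxSubgroup hk) hke, hν k hk, Circle.coe_one, one_smul]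

/-- (Ported verbatim from the HodgeCMPerL package; no docstring in the source.) -/
theorem rep_phiE_eq_self_of_mem_boxSubgroup (e : Space L) (T : Finset (Place L⁺))
    (he : ∀ j : SplitIdx L, j.1 ∉ T → e j = 0) :
    ∀ k ∈ RestrictedProduct.boxSubgroup (genLevel L) T, rep L 1 k (phiE e) = phiE e :=
  rep_phiE_eq_self_of_mem_boxSubgroup_of_char e 1 T he fun _ _ => rfl

/-- the local overlap volume `vol_v((c + 𝒪_v³) ∩ u⁻¹(c + 𝒪_v³))` -/
def locVolE (j : SplitIdx L) (c : Coord L j) (u : (𝕂 j)ˣ) : ℝ≥0∞ :=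
  Adic.muV L⁺ (basePlaceOf L j.1) (closedBall c 1 ∩ (fun y : Coord L j => (u : 𝕂 j) • y) ⁻¹' closedBall c 1)

/-- (Ported verbatim from the HodgeCMPerL package; no docstring in the source.) -/
theorem muV_closedBall_one (j : SplitIdx L) (c : Coord L j) : Adic.muV L⁺ (basePlaceOf L j.1) (closedBall c 1) = 1 := by
  rw [addHaar_closedBall_center, Adic.muV,
    show closedBall (0 : Coord L j) 1 = (Adic.integerCube L⁺ (basePlaceOf L j.1) : Set (Coord L j)) from rfl,
    addHaarMeasure_self]

/-- (Ported verbatim from the HodgeCMPerL package; no docstring in the source.) -/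
@[simp] theorem locVolE_one (j : SplitIdx L) (c : Coord L j) : locVolE j c 1 = 1 := by
  have h : (fun y : Coord L j => ((1 : (𝕂 j)ˣ) : 𝕂 j) • y) ⁻¹' closedBall c 1 = closedBall c 1 := by
    ext y
    rw [mem_preimage, Units.val_one, one_smul]
  rw [locVolE, h, inter_self, muV_closedBall_one]

/-- the overlap set at the coordinate `j`, translated back into `𝒪_j³` -/
def olapE (e : Space L) (k : Model L) (j : SplitIdx L) : Set (Coord L j) :=
  (fun y : Coord L j => e j + y) ⁻¹'
    (closedBall (e j) 1 ∩ (fun y : Coord L j => ((unitAt k j : (𝕂 j)ˣ) : 𝕂 j) • y) ⁻¹' closedBall (e j) 1)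

/-- (Ported verbatim from the HodgeCMPerL package; no docstring in the source.) -/
theorem measurableSet_olapE (e : Space L) (k : Model L) (j : SplitIdx L) : MeasurableSet (olapE e k j) :=
  (measurableSet_closedBall.inter (measurableSet_closedBall.preimage (measurable_const_smul _))).preimage
    (measurable_const_add _)

/-- (Ported verbatim from the HodgeCMPerL package; no docstring in the source.) -/
theorem mem_olapE_iff (e : Space L) (k : Model L) (j : SplitIdx L) (y : Coord L j) :
    y ∈ olapE e k j ↔ y ∈ cube L j ∧ -e j + ((unitAt k j : (𝕂 j)ˣ) : 𝕂 j) • (e j + y) ∈ cube L j := by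
  rw [olapE, mem_preimage, mem_inter_iff, mem_preimage, ← neg_add_mem_cube_iff, ← neg_add_mem_cube_iff,
    neg_add_cancel_left]

/-- (Ported verbatim from the HodgeCMPerL package; no docstring in the source.) -/
theorem olapE_subset_cube (e : Space L) (k : Model L) (j : SplitIdx L) :
    olapE e k j ⊆ (cube L j : Set (Coord L j)) := fun y hy => ((mem_olapE_iff e k j y).1 hy).1

/-- (Ported verbatim from the HodgeCMPerL package; no docstring in the source.) -/
theorem muV_olapE (e : Space L) (k : Model L) (j : SplitIdx L) :
    Adic.muV L⁺ (basePlaceOf L j.1) (olapE e k j) = locVolE j (e j) (unitAt k j) := by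
  rw [olapE, measure_preimage_add]
  rfl

/-- the overlap `(e + box) ∩ k⁻¹(e + box)`, translated by `-e`, is a sub-box of `∏ 𝒪³` -/
theorem preimage_add_boxE_inter (e : Space L) (k : Model L) (S : Finset (SplitIdx L))
    (hS : ∀ j : SplitIdx L, j ∉ S → ‖((unitAt k j : (𝕂 j)ˣ) : 𝕂 j)‖ = 1) (heS : ∀ j : SplitIdx L, j ∉ S → e j = 0) :
    (fun x : Space L => e + x) ⁻¹' (boxE e ∩ (fun x : Space L => k • x) ⁻¹' boxE e) = subbox L S (olapE e k) := by
  ext x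
  simp only [mem_preimage, mem_inter_iff, mem_boxE_iff, mem_subbox_iff, mem_olapE_iff, smul_apply,
    RestrictedProduct.add_apply, neg_add_cancel_left]
  constructor
  · rintro ⟨h1, h2⟩
    exact ⟨h1, fun j _ => ⟨h1 j, h2 j⟩⟩
  · rintro ⟨h1, h2⟩
    refine ⟨h1, fun j => ?_⟩
    by_cases hj : j ∈ S
    · exact (h2 j hj).2
    · rw [heS j hj, neg_zero, zero_add, zero_add]
      exact (smul_mem_cube_iff j (hS j hj) (x j)).2 (h1 j)

/-- **the diagonal coefficient of `φ_e`**: `⟪φ_e, ω_ν(k) φ_e⟫ = weight_ν(k) · ∏_{j ∈ S} vol_j((e_j+𝒪³) ∩ u_j⁻¹(e_j+𝒪³))`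
for any finite `S` of split indices off which `k` has norm-one coordinates and `e` vanishes -/
theorem inner_phiE_rep (e : Space L) (ν : Model L →* Circle) (k : Model L) (S : Finset (SplitIdx L))
    (hS : ∀ j : SplitIdx L, j ∉ S → ‖((unitAt k j : (𝕂 j)ˣ) : 𝕂 j)‖ = 1) (heS : ∀ j : SplitIdx L, j ∉ S → e j = 0) :
    ⟪phiE e, rep L ν k (phiE e)⟫_ℂ = weight (Space L) ν k * ((∏ j ∈ S, locVolE j (e j) (unitAt k j)).toReal : ℂ) := by
  have h := inner_indicator_dilationRep (μ L) ν k (measurableSet_boxE e) (by rw [μ_boxE]; exact ENNReal.one_ne_top)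
  have key : ∏ j ∈ S, Adic.muV L⁺ (basePlaceOf L j.1) ((cube L j : Set (Coord L j)) ∩ olapE e k j) =
      ∏ j ∈ S, locVolE j (e j) (unitAt k j) :=
    Finset.prod_congr rfl fun j _ => by rw [inter_eq_right.2 (olapE_subset_cube e k j), muV_olapE]
  rw [phiE, h, measureReal_def, ← measure_preimage_add (μ L) e (boxE e ∩ (fun x : Space L => k • x) ⁻¹' boxE e),
    preimage_add_boxE_inter e k S hS heS, measure_subbox (fun j => measurableSet_olapE e k j) S, key]

/-- **multiplicativity on disjointly supported pairs** of the diagonal coefficient of `φ_e` -/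
theorem inner_phiE_rep_mul_of_disjoint (e : Space L) (Se : Finset (SplitIdx L))
    (heS : ∀ j : SplitIdx L, j ∉ Se → e j = 0) (ν : Model L →* Circle) :
    ∀ a b : Model L, (∀ i, a i = 1 ∨ b i = 1) →
      ⟪phiE e, rep L ν (a * b) (phiE e)⟫_ℂ = ⟪phiE e, rep L ν a (phiE e)⟫_ℂ * ⟪phiE e, rep L ν b (phiE e)⟫_ℂ := by
  intro a b hab
  set S : Finset (SplitIdx L) := exc a ∪ exc b ∪ Se with hSdef
  have ha : ∀ j : SplitIdx L, j ∉ S → ‖((unitAt a j : (𝕂 j)ˣ) : 𝕂 j)‖ = 1 := fun j hj =>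
    norm_unitAt_of_not_mem_exc a fun h => hj (Finset.mem_union_left _ (Finset.mem_union_left _ h))
  have hb : ∀ j : SplitIdx L, j ∉ S → ‖((unitAt b j : (𝕂 j)ˣ) : 𝕂 j)‖ = 1 := fun j hj =>
    norm_unitAt_of_not_mem_exc b fun h => hj (Finset.mem_union_left _ (Finset.mem_union_right _ h))
  have he : ∀ j : SplitIdx L, j ∉ S → e j = 0 := fun j hj => heS j fun h => hj (Finset.mem_union_right _ h)
  have hab' : ∀ j : SplitIdx L, j ∉ S → ‖((unitAt (a * b) j : (𝕂 j)ˣ) : 𝕂 j)‖ = 1 := fun j hj => by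
    rw [unitAt_mul, Units.val_mul, norm_mul, ha j hj, hb j hj, one_mul]
  rw [inner_phiE_rep e ν (a * b) S hab' he, inner_phiE_rep e ν a S ha he, inner_phiE_rep e ν b S hb he, weight_mul]
  have key : ∏ j ∈ S, locVolE j (e j) (unitAt (a * b) j) =
      (∏ j ∈ S, locVolE j (e j) (unitAt a j)) * ∏ j ∈ S, locVolE j (e j) (unitAt b j) := by
    rw [← Finset.prod_mul_distrib]
    refine Finset.prod_congr rfl fun j _ => ?_
    rw [unitAt_mul]
    rcases hab j.1 with h | h
    · rw [unitAt_eq_one_of_apply_eq_one h, one_mul, locVolE_one, one_mul]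
    · rw [unitAt_eq_one_of_apply_eq_one h, mul_one, locVolE_one, mul_one]
  rw [key, ENNReal.toReal_mul, Complex.ofReal_mul]
  ring


-- port_pkg: scope closed for this part
end Main
end Coeff
end SchrodingerModel
end HodgeCM.PerL34.PureTensor
end
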